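import Summits.KontsevichZagierPeriods.KontsevichZagierPeriods.Theorems.HoffmanRelationInKZ.Negative.HoffmanElement

/-!
# Crux `HoffmanRelationInKZ` (stmt-KontsevichZagierPeriods-3930): no-Stokes locality — without Newton–Leibniz there are no auxiliary variables

Landed copy of §3c of `Cruxes/HoffmanRelationInKZ/Disproof.lean` (crux disprover). The three Stokes-free
move sets are homogeneous in the dimension, so the projection `dimProj n` onto dimension-`n` generators
maps the Stokes-free sub-calculus `noStokes = closure(1a ∪ 1b ∪ 2)` into its dimension-`n` part
(`dimProj_mem_noStokesDim`). Hoffman's element at `s` is pure of dimension `w + 1`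
(`dimProj_hoffmanElement`), hence `noStokes_locality`: **a Newton–Leibniz-free move-proof of Hoffman(s)
is a chain among `(w+1)`-dimensional representations only** — no extra variable, no product with an
interval, no homotopy parameter. Newton–Leibniz generators are never dimension-pure
(`dimProj_newtonLeibniz_shape`). Whether Newton–Leibniz is necessary for `s = (3)` is OPEN; by locality
it is a question about 4-dimensional scissors-and-substitution chains.

Reference: M. Kontsevich, D. Zagier, *Periods* (2001), §1.2.
-/

noncomputable section

namespace Summit.KontsevichZagierPeriods.HoffmanRelationInKZ.Negative

open MeasureTheory Set
open Literature.NumberTheory.Transcendental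
open Literature.NumberTheory.Transcendental.KZ
open Summit.KontsevichZagierPeriods.KontsevichZagierPeriods.Theses.FurushoPentagon

/-! ## No-Stokes locality: without Newton–Leibniz there are no auxiliary variables

The three Stokes-free move sets are homogeneous in the dimension, so the projection `P_n` of
`FormalRep` onto its dimension-`n` generators maps the Stokes-free sub-calculus `noStokes` into its
dimension-`n` part. Hoffman's element at `s` is pure of dimension `w + 1`; hence **a move-proof of
Hoffman(s) avoiding Newton–Leibniz is a chain among `(w+1)`-dimensional representations only** — no
extra variable, no product with an interval, no homotopy parameter. Every chain proposed so far for
`s = (3)` (the crux ideas `dilation-homotopy-transposition`, `collar-blowup-uphill-stokes`, the route's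
own pentagon/Stokes-on-`X₅` lever) introduces a variable and descends by Newton–Leibniz; by this
locality that is not an artefact of presentation unless a purely 4-dimensional scissors-and-substitution
proof of `ζ(4) = ζ(3,1) + ζ(2,2)` exists (OPEN; cf. route ScissorsAvatars). -/

section NoStokes

/-- Projection of `FormalRep` onto its dimension-`n` generators. -/
def dimProj (n : ℕ) : FormalRep →+ FormalRep :=
  FreeAbelianGroup.lift fun r => if r.1 = n then FreeAbelianGroup.of r else 0

/-- `P_n [r] = [r]` if `r` has dimension `n`, else `0`. [folklore] -/
theorem dimProj_of (n : ℕ) {m : ℕ} (r : IntegralRep m) :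
    dimProj n (of r) = if m = n then of r else 0 := by
  simp only [dimProj, of, FreeAbelianGroup.lift_apply_of]

/-- `P_n` fixes dimension-`n` generators. [folklore] -/
@[simp] theorem dimProj_of_self {n : ℕ} (r : IntegralRep n) : dimProj n (of r) = of r := by
  rw [dimProj_of, if_pos rfl]

/-- `P_n` kills generators of other dimensions. [folklore] -/
theorem dimProj_of_ne {n m : ℕ} (r : IntegralRep m) (h : m ≠ n) : dimProj n (of r) = 0 := by
  rw [dimProj_of, if_neg h]

/-- Domain additivity among `n`-dimensional representations. -/
def domainAddRelDim (n : ℕ) : Set FormalRep :=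
  {c | ∃ (r r₁ r₂ : IntegralRep n), r.domain = r₁.domain ∪ r₂.domain ∧
    volume (r₁.domain ∩ r₂.domain) = 0 ∧ EqOn r.integrand r₁.integrand r₁.domain ∧
    EqOn r.integrand r₂.integrand r₂.domain ∧ c = of r - of r₁ - of r₂}

/-- Integrand additivity among `n`-dimensional representations. -/
def integrandAddRelDim (n : ℕ) : Set FormalRep :=
  {c | ∃ (r r₁ r₂ : IntegralRep n), r₁.domain = r.domain ∧ r₂.domain = r.domain ∧
    EqOn r.integrand (r₁.integrand + r₂.integrand) r.domain ∧ c = of r - of r₁ - of r₂}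

/-- Changes of variables among `n`-dimensional representations. -/
def changeOfVariablesRelDim (n : ℕ) : Set FormalRep :=
  {c | ∃ (r r' : IntegralRep n) (Φ : (Fin n → ℝ) → (Fin n → ℝ))
      (Φ' : (Fin n → ℝ) → (Fin n → ℝ) →L[ℝ] (Fin n → ℝ)),
    IsSemialgebraicMapOn ℚ r.domain Φ ∧ (∀ x ∈ r.domain, HasFDerivWithinAt Φ (Φ' x) r.domain x) ∧
    InjOn Φ r.domain ∧ r'.domain = Φ '' r.domain ∧
    (∀ x ∈ r.domain, r.integrand x = r'.integrand (Φ x) * |(Φ' x).det|) ∧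
    c = of r - of r'}

/-- The Stokes-free sub-calculus (moves (1a), (1b), (2)). -/
def noStokes : AddSubgroup FormalRep :=
  AddSubgroup.closure (domainAddRel ∪ integrandAddRel ∪ changeOfVariablesRel)

/-- Its dimension-`n` part: the same three moves among `n`-dimensional representations. -/
def noStokesDim (n : ℕ) : AddSubgroup FormalRep :=
  AddSubgroup.closure (domainAddRelDim n ∪ integrandAddRelDim n ∪ changeOfVariablesRelDim n)

/-- `noStokes ≤ relations`. [folklore] -/
theorem noStokes_le_relations : noStokes ≤ relations :=
  AddSubgroup.closure_mono fun _ hc => Or.inl hc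

/-- The dimension-`n` Stokes-free moves are Stokes-free moves. [folklore] -/
theorem noStokesDim_le_noStokes (n : ℕ) : noStokesDim n ≤ noStokes := by
  refine AddSubgroup.closure_mono ?_
  rintro c ((hc | hc) | hc)
  · obtain ⟨r, r₁, r₂, h1, h2, h3, h4, rfl⟩ := hc
    exact Or.inl (Or.inl ⟨n, r, r₁, r₂, h1, h2, h3, h4, rfl⟩)
  · obtain ⟨r, r₁, r₂, h1, h2, h3, rfl⟩ := hc
    exact Or.inl (Or.inr ⟨n, r, r₁, r₂, h1, h2, h3, rfl⟩)
  · obtain ⟨r, r', Φ, Φ', h1, h2, h3, h4, h5, rfl⟩ := hc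
    exact Or.inr ⟨n, r, r', Φ, Φ', h1, h2, h3, h4, h5, rfl⟩

/-- **Locality**: the dimension-`n` projection of a Stokes-free relation is a Stokes-free relation among
`n`-dimensional representations. -/
theorem dimProj_mem_noStokesDim (n : ℕ) {c : FormalRep} (hc : c ∈ noStokes) :
    dimProj n c ∈ noStokesDim n := by
  induction hc using AddSubgroup.closure_induction with
  | mem x hx =>
    rcases hx with (hx | hx) | hx
    · obtain ⟨m, r, r₁, r₂, h1, h2, h3, h4, rfl⟩ := hx
      by_cases hmn : m = n
      · subst hmn
        simp only [map_sub, dimProj_of_self]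
        exact AddSubgroup.subset_closure (Or.inl (Or.inl ⟨r, r₁, r₂, h1, h2, h3, h4, rfl⟩))
      · simp [map_sub, dimProj_of_ne _ hmn]
    · obtain ⟨m, r, r₁, r₂, h1, h2, h3, rfl⟩ := hx
      by_cases hmn : m = n
      · subst hmn
        simp only [map_sub, dimProj_of_self]
        exact AddSubgroup.subset_closure (Or.inl (Or.inr ⟨r, r₁, r₂, h1, h2, h3, rfl⟩))
      · simp [map_sub, dimProj_of_ne _ hmn]
    · obtain ⟨m, r, r', Φ, Φ', h1, h2, h3, h4, h5, rfl⟩ := hx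
      by_cases hmn : m = n
      · subst hmn
        simp only [map_sub, dimProj_of_self]
        exact AddSubgroup.subset_closure (Or.inr ⟨r, r', Φ, Φ', h1, h2, h3, h4, h5, rfl⟩)
      · simp [map_sub, dimProj_of_ne _ hmn]
  | zero => simp
  | add x y _ _ hx hy => rw [map_add]; exact AddSubgroup.add_mem _ hx hy
  | neg x _ hx => rw [map_neg]; exact AddSubgroup.neg_mem _ hx

/-- A dimension-pure Stokes-free relation is a Stokes-free relation IN ITS OWN DIMENSION. -/
theorem mem_noStokesDim_of_pure {n : ℕ} {c : FormalRep} (hc : c ∈ noStokes) (hpure : dimProj n c = c) :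
    c ∈ noStokesDim n := hpure ▸ dimProj_mem_noStokesDim n hc

/-- Raising adds one to the weight. -/
theorem weight_raise {s : List ℕ} {i : ℕ} (hi : i < s.length) : MZV.weight (raise s i) = MZV.weight s + 1 := by
  induction s generalizing i with
  | nil => simp at hi
  | cons a t ih =>
    cases i with
    | zero => simp [MZV.weight]; omega
    | succ i =>
      have hi' : i < t.length := by simpa using hi
      have := ih hi'
      simp only [MZV.weight, raise_cons_succ, List.sum_cons] at this ⊢
      omega

/-- Splitting adds one to the weight. -/
theorem weight_split {s : List ℕ} {i j : ℕ} (hi : i < s.length) (hj : j < s.getD i 0 - 1) :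
    MZV.weight (split s i j) = MZV.weight s + 1 := by
  induction s generalizing i with
  | nil => simp at hi
  | cons a t ih =>
    cases i with
    | zero =>
      simp only [List.getD_cons_zero] at hj
      simp [MZV.weight]; omega
    | succ i =>
      have hi' : i < t.length := by simpa using hi
      simp only [List.getD_cons_succ] at hj
      have := ih hi' hj
      simp only [MZV.weight, split_cons_succ, List.sum_cons] at this ⊢
      omega

/-- Hoffman's element is pure of dimension `w + 1`. -/
theorem dimProj_hoffmanElement {Z : List ℕ → FormalRep} (hZ : Pinned Z) {s : List ℕ}
    (hs : MZV.IsAdmissible s) : dimProj (MZV.weight s + 1) (hoffmanElement Z s) = hoffmanElement Z s := by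
  rw [hoffmanElement_eq, map_sub, map_list_sum, map_list_sum, List.map_map, List.map_map]
  congr 1
  · congr 1
    refine List.map_congr_left fun i hi => ?_
    have hi' := List.mem_range.mp hi
    rw [Function.comp_apply, hZ _ (isAdmissible_raise hs hi'), dimProj_of, if_pos (weight_raise hi')]
  · congr 1
    refine List.map_congr_left fun i hi => ?_
    have hi' := List.mem_range.mp hi
    rw [Function.comp_apply, map_list_sum, List.map_map]
    congr 1
    refine List.map_congr_left fun j hj => ?_
    have hj' := List.mem_range.mp hj
    rw [Function.comp_apply, hZ _ (isAdmissible_split hs hi' hj'), dimProj_of, if_pos (weight_split hi' hj')]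

/-- **No-Stokes locality for the crux**: a Newton–Leibniz-free move-proof of Hoffman(s) is a chain of
domain/integrand additivity and changes of variables among `(w+1)`-dimensional representations only.
[folklore] -/
theorem noStokes_locality {Z : List ℕ → FormalRep} (hZ : Pinned Z) {s : List ℕ} (hs : MZV.IsAdmissible s)
    (h : hoffmanElement Z s ∈ noStokes) : hoffmanElement Z s ∈ noStokesDim (MZV.weight s + 1) :=
  mem_noStokesDim_of_pure h (dimProj_hoffmanElement hZ hs)

/-- In particular at `s = (3)`: a Stokes-free proof of `ζ(4) = ζ(3,1) + ζ(2,2)` would be a purely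
4-dimensional scissors-and-substitution chain. -/
theorem noStokes_locality_three (h : hoffmanElement zetaRep [3] ∈ noStokes) :
    hoffmanElement zetaRep [3] ∈ noStokesDim 4 := by
  have h4 : MZV.weight [3] + 1 = 4 := by decide
  have := noStokes_locality pinned_zetaRep (s := [3]) (by decide) h
  rwa [h4] at this

/-- Newton–Leibniz generators are never dimension-pure: `P_n` of `[band] − [base]` (band in dimension
`n + 1`) is `−[base]`, and `P_{n+1}` of it is `[band]`; neither is a relation unless of value `0`. This
is the only move the locality argument does not cover — the whole question "is Stokes needed for
Hoffman?" is concentrated here. -/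
theorem dimProj_newtonLeibniz_shape {n : ℕ} (r : IntegralRep (n + 1)) (r' : IntegralRep n) :
    dimProj n (of r - of r') = -of r' ∧ dimProj (n + 1) (of r - of r') = of r := by
  constructor
  · rw [map_sub, dimProj_of_ne r (Nat.succ_ne_self n), dimProj_of_self, zero_sub]
  · rw [map_sub, dimProj_of_self, dimProj_of_ne r' (by omega), sub_zero]

end NoStokes


end Summit.KontsevichZagierPeriods.HoffmanRelationInKZ.Negative
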